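import Mathlib
import Summits.BirchSwinnertonDyer.BirchSwinnertonDyer.Theorems.KatoDescentTamePotSupersingularTameLowerFibreAdjointBricksFiveCommutator
import Literature.NumberTheory.GaloisRepresentations.PadicIntermediateFieldIntegers
import Literature.NumberTheory.GaloisRepresentations.CompleteLocalFiniteLevels

/-!
# Bricks for the `GL₂(𝔽₅)`-lifting route (T5′), XIX: the MODELS — `ℤ₅`, `𝒪_L` (`L/ℚ₅` finite) and
# continuous representations of compact groups (class-based currency)

Continuation of file XVIII (`…AdjointBricksFiveCommutator`, same namespace). Files XVI–XVIII are
instance-free: `(A, 𝔪)` precomplete with finite levels, closedness of `G`, `N ≤ GL₂(A)` «entrywise modulo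
every `𝔪ⁿ`», residual covering as congruences. This file discharges every RING-side binder for the two
models of T-S7r07-1 (Δ1@5) and feeds the closedness binder from Mathlib's topology on `GL₂(A)`:

* `entrywiseClosed_of_isClosed` — if `𝔪`-adic approximations converge in the topology of `A`, a subgroup
  of `GL₂(A)` closed for the units topology is closed in the sense of XVI;
* `exists_conj_SL2_padicInt_le_of_isClosed_of_commutator_le` — GENERIC class-based form of XVIII: `A` a
  Noetherian adically complete local ring with finite residue field, `5 ∈ 𝔪`, a topology in which
  `𝔪`-adic approximations converge; `G`, `N` CLOSED, `N ⊇` commutators of `G`, `G mod 𝔪 ⊇ GL₂(𝔽₅)`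
  ⇒ `u · φ(SL₂(ℤ₅)) · u⁻¹ ⊆ G ∩ N` (`u ≡ 1`, every `φ : ℤ₅ → A`);
* **`A = ℤ₅`**: `exists_conj_SL2_le_of_isClosed_padicInt` — closed `G, N ≤ GL₂(ℤ₅)`, `N ⊇ [G,G]`,
  `G → GL₂(𝔽₅)` onto (stated with `PadicInt.toZMod`) ⇒ `u · SL₂(ℤ₅) · u⁻¹ ⊆ G ∩ N` with `u ≡ 1 (mod 5)`;
* **`A = 𝒪_L`** (`L ⊆ ℚ̄₅` finite over `ℚ₅`, EVERY ramification index — all Δ1 rings):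
  `exists_conj_SL2_le_of_isClosed_intermediateFieldIntegers`, and `exists_ringHom_padicInt_intermediateFieldIntegers`
  (the structure map `ℤ₅ → 𝒪_L` exists, so the conclusion is not vacuous);
* **compact groups** ((C1)'s entrance): for a CONTINUOUS `ρ : Γ →* GL₂(A)` of a COMPACT group `Γ` and a
  closed subgroup `Γ₀ ≤ Γ` containing the commutators (e.g. `Γ = G_ℚ`, `Γ₀ = Gal(ℚ̄/ℚ(ζ_{5^∞}))`), the
  images `ρ(Γ)`, `ρ(Γ₀)` are compact hence closed, so the ONLY remaining hypothesis on `ρ` is the residual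
  one: `exists_conj_SL2_le_range_padicInt`, `exists_conj_SL2_le_range_intermediateFieldIntegers` —
  `u · SL₂(ℤ₅) · u⁻¹ ⊆ ρ(Γ₀)`, i.e. Kato's (12.5.2) for the lattice `u·(standard basis)`.

This is ADD-1 §C (C0) (T5′) of ARM-P r07's S7 dossier in class-based currency (the reader's K24f
blueprint of ADD-12, here over XVIII so that Kato's (12.5.2) shape is included). Route-free, no
definitions, nothing about elliptic curves or items 19618/19981 (open). Target T-S7r07-1
(`FibreLatticeInput 5`, Δ1@5).
-/

set_option linter.dupNamespace false

open Matrix IsLocalRing Filter Topology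
open scoped MatrixGroups

namespace Summit.BirchSwinnertonDyer.BirchSwinnertonDyer.Theorems.GL2F5AdjointBricks

section models

universe u

/-! ### From the units topology to XVI's entrywise closedness -/

/-- Inverses of entrywise-congruent invertible matrices are entrywise congruent. -/
theorem inv_val_sub_inv_val_mem {A : Type u} [CommRing A] (I : Ideal A) (h g : GL (Fin 2) A)
    (hh : ∀ i j, h.val i j - g.val i j ∈ I) (i j : Fin 2) :
    (h⁻¹).val i j - (g⁻¹).val i j ∈ I := by
  have key : (h⁻¹).val - (g⁻¹).val = (h⁻¹).val * (g.val - h.val) * (g⁻¹).val := by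
    rw [Matrix.mul_sub, Matrix.sub_mul, Matrix.mul_assoc ((h⁻¹).val) g.val, Units.mul_inv, Matrix.mul_one,
      Units.inv_mul, Matrix.one_mul]
  rw [← Matrix.sub_apply, key]
  refine mul_mul_apply_mem_of_forall_mem I _ _ _ (fun k l => ?_) i j
  rw [Matrix.sub_apply, ← neg_sub]
  exact I.neg_mem (hh k l)

/-- If `𝔪`-adic approximations converge in the topology of `A`, a subgroup of `GL₂(A)` that is CLOSED for
the units topology is closed in the sense of file XVI (entrywise modulo every `𝔪ⁿ`). -/
theorem entrywiseClosed_of_isClosed {A : Type u} [CommRing A] [TopologicalSpace A] (𝔪 : Ideal A)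
    (hT : ∀ (x : ℕ → A) (y : A), (∀ n, x n - y ∈ 𝔪 ^ n) → Tendsto x atTop (𝓝 y))
    (N : Subgroup (GL (Fin 2) A)) (hN : IsClosed (N : Set (GL (Fin 2) A))) :
    ∀ g : GL (Fin 2) A, (∀ n : ℕ, ∃ g' ∈ N, ∀ i j, g.val i j - g'.val i j ∈ 𝔪 ^ n) → g ∈ N := by
  intro g hg
  choose h hhN hh' using hg
  have hh : ∀ n i j, (h n).val i j - g.val i j ∈ 𝔪 ^ n := fun n i j => by
    rw [← neg_sub]; exact (𝔪 ^ n).neg_mem (hh' n i j)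
  have hinv : ∀ n i j, ((h n)⁻¹).val i j - (g⁻¹).val i j ∈ 𝔪 ^ n :=
    fun n i j => inv_val_sub_inv_val_mem (𝔪 ^ n) (h n) g (hh n) i j
  have hval : Tendsto (fun n => (h n).val) atTop (𝓝 g.val) :=
    tendsto_pi_nhds.2 fun i => tendsto_pi_nhds.2 fun j => hT (fun n => (h n).val i j) (g.val i j) fun n => hh n i j
  have hival : Tendsto (fun n => ((h n)⁻¹).val) atTop (𝓝 (g⁻¹).val) :=
    tendsto_pi_nhds.2 fun i => tendsto_pi_nhds.2 fun j =>
      hT (fun n => ((h n)⁻¹).val i j) ((g⁻¹).val i j) fun n => hinv n i j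
  have ht : Tendsto h atTop (𝓝 g) := by
    rw [Units.isInducing_embedProduct.tendsto_nhds_iff]
    exact hval.prodMk_nhds ((MulOpposite.continuous_op.tendsto _).comp hival)
  exact hN.mem_of_tendsto ht (Eventually.of_forall hhN)

/-- Residual covering stated through a reduction map `res : A → 𝔽₅` with kernel inside `𝔪` (e.g.
`PadicInt.toZMod`) implies XVI's congruence form of `hres`. -/
theorem hres_of_map_eq {A : Type u} [CommRing A] (𝔪 : Ideal A) (res : A →+* ZMod 5)
    (hker : ∀ a : A, res a = 0 → a ∈ 𝔪) (G : Subgroup (GL (Fin 2) A))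
    (hres : ∀ q : GL (Fin 2) (ZMod 5), ∃ g ∈ G, Matrix.GeneralLinearGroup.map res g = q) :
    ∀ q : GL (Fin 2) (ZMod 5), ∃ g ∈ G, ∀ i j, g.val i j - ((q.val i j).val : ℕ) ∈ 𝔪 := by
  intro q
  obtain ⟨g, hgG, hg⟩ := hres q
  refine ⟨g, hgG, fun i j => hker _ ?_⟩
  have e : res (g.val i j) = q.val i j := by
    rw [← hg]; rfl
  rw [map_sub, e, map_natCast, ZMod.natCast_zmod_val, sub_self]

/-! ### The generic class-based form -/

/-- **(C0) (T5′) in Kato's (12.5.2) shape, class-based currency.** `A` a Noetherian local ring, adically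
complete for `𝔪 = maximalIdeal A`, finite residue field, `5 ∈ 𝔪`, with a topology in which `𝔪`-adic
approximations converge; `G, N ≤ GL₂(A)` CLOSED (units topology), `N` containing the commutators of `G`,
and `G mod 𝔪 ⊇ GL₂(𝔽₅)`. Then some `u ≡ 1 (mod 𝔪)` has `u · φ(s) · u⁻¹ ∈ G` and `∈ N` for every ring map
`φ : ℤ₅ → A` and every `s ∈ SL₂(ℤ₅)`. -/
theorem exists_conj_SL2_padicInt_le_of_isClosed_of_commutator_le [Fact (Nat.Prime 5)] {A : Type u}
    [CommRing A] [TopologicalSpace A] [IsLocalRing A] [IsNoetherianRing A] [Finite (ResidueField A)]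
    [IsAdicComplete (maximalIdeal A) A]
    (hT : ∀ (x : ℕ → A) (y : A), (∀ n, x n - y ∈ maximalIdeal A ^ n) → Tendsto x atTop (𝓝 y))
    (h5 : (5 : A) ∈ maximalIdeal A) (G N : Subgroup (GL (Fin 2) A))
    (hG : IsClosed (G : Set (GL (Fin 2) A))) (hN : IsClosed (N : Set (GL (Fin 2) A)))
    (hGN : ∀ a ∈ G, ∀ b ∈ G, a * b * a⁻¹ * b⁻¹ ∈ N)
    (hres : ∀ q : GL (Fin 2) (ZMod 5), ∃ g ∈ G, ∀ i j, g.val i j - ((q.val i j).val : ℕ) ∈ maximalIdeal A) :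
    ∃ u : GL (Fin 2) A, (∀ i j, u.val i j - (1 : Matrix (Fin 2) (Fin 2) A) i j ∈ maximalIdeal A) ∧
      ∀ (φ : ℤ_[5] →+* A) (s : SL(2, ℤ_[5])),
        u * Matrix.GeneralLinearGroup.map φ (Matrix.SpecialLinearGroup.toGL s) * u⁻¹ ∈ G ∧
          u * Matrix.GeneralLinearGroup.map φ (Matrix.SpecialLinearGroup.toGL s) * u⁻¹ ∈ N :=
  exists_conj_SL2_padicInt_le_of_closed_of_commutator_le_localRing A
    (fun n => Literature.NumberTheory.GaloisRepresentations.CompleteLocalRing.finite_quotient_maximalIdeal_pow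
      (R := A) (n + 1))
    h5 G N (entrywiseClosed_of_isClosed (maximalIdeal A) hT G hG)
    (entrywiseClosed_of_isClosed (maximalIdeal A) hT N hN) hGN hres

/-! ### Model `A = ℤ₅` -/

/-- `𝔪`-adic approximations converge in `ℤ_p`. -/
theorem padicInt_tendsto_of_forall_sub_mem_pow {p : ℕ} [Fact p.Prime] (x : ℕ → ℤ_[p]) (y : ℤ_[p])
    (h : ∀ n, x n - y ∈ maximalIdeal ℤ_[p] ^ n) : Tendsto x atTop (𝓝 y) := by
  rw [← tendsto_sub_nhds_zero_iff]
  have hp1 : ((p : ℝ)⁻¹) < 1 := inv_lt_one_of_one_lt₀ (by exact_mod_cast (Fact.out : p.Prime).one_lt)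
  have hp0 : 0 ≤ ((p : ℝ)⁻¹) := by positivity
  refine squeeze_zero_norm (a := fun n => ((p : ℝ)⁻¹) ^ n) (fun n => ?_)
    (tendsto_pow_atTop_nhds_zero_of_lt_one hp0 hp1)
  have hn := h n
  rw [PadicInt.maximalIdeal_eq_span_p, Ideal.span_singleton_pow, ← PadicInt.norm_le_pow_iff_mem_span_pow] at hn
  simpa only [_root_.zpow_neg, zpow_natCast, inv_pow] using hn

/-- The residue field of `ℤ_p` is finite. -/
theorem finite_residueField_padicInt {p : ℕ} [Fact p.Prime] : Finite (ResidueField ℤ_[p]) :=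
  Finite.of_equiv _ (PadicInt.residueField (p := p)).symm.toEquiv

/-- **(C0) (T5′) at `A = ℤ₅`, Kato's shape.** Let `G, N ≤ GL₂(ℤ₅)` be closed subgroups with `N`
containing every commutator of elements of `G` (e.g. `N = G`), and let `G → GL₂(𝔽₅)` be onto. Then for
some `u ∈ GL₂(ℤ₅)` with `u ≡ 1 (mod 5)`: `u · SL₂(ℤ₅) · u⁻¹ ⊆ G` and `⊆ N`. -/
theorem exists_conj_SL2_le_of_isClosed_padicInt [Fact (Nat.Prime 5)] (G N : Subgroup (GL (Fin 2) ℤ_[5]))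
    (hG : IsClosed (G : Set (GL (Fin 2) ℤ_[5]))) (hN : IsClosed (N : Set (GL (Fin 2) ℤ_[5])))
    (hGN : ∀ a ∈ G, ∀ b ∈ G, a * b * a⁻¹ * b⁻¹ ∈ N)
    (hres : ∀ q : GL (Fin 2) (ZMod 5), ∃ g ∈ G, Matrix.GeneralLinearGroup.map PadicInt.toZMod g = q) :
    ∃ u : GL (Fin 2) ℤ_[5], Matrix.GeneralLinearGroup.map PadicInt.toZMod u = 1 ∧
      ∀ s : SL(2, ℤ_[5]),
        u * Matrix.SpecialLinearGroup.toGL s * u⁻¹ ∈ G ∧ u * Matrix.SpecialLinearGroup.toGL s * u⁻¹ ∈ N := by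
  haveI : Finite (ResidueField ℤ_[5]) := finite_residueField_padicInt
  have h5 : (5 : ℤ_[5]) ∈ maximalIdeal ℤ_[5] := by
    rw [PadicInt.maximalIdeal_eq_span_p]
    exact_mod_cast Ideal.mem_span_singleton_self ((5 : ℕ) : ℤ_[5])
  have hker : ∀ a : ℤ_[5], PadicInt.toZMod a = 0 → a ∈ maximalIdeal ℤ_[5] := fun a ha => by
    rw [← PadicInt.ker_toZMod, RingHom.mem_ker]; exact ha
  obtain ⟨u, hu1, hu⟩ := exists_conj_SL2_padicInt_le_of_isClosed_of_commutator_le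
    padicInt_tendsto_of_forall_sub_mem_pow h5 G N hG hN hGN
    (hres_of_map_eq (maximalIdeal ℤ_[5]) PadicInt.toZMod hker G hres)
  refine ⟨u, ?_, fun s => ?_⟩
  · apply Units.ext
    ext i j
    have h := hu1 i j
    rw [← PadicInt.ker_toZMod, RingHom.mem_ker, map_sub, sub_eq_zero] at h
    rw [Matrix.GeneralLinearGroup.map_apply, h, Matrix.one_apply, Units.val_one, Matrix.one_apply]
    split_ifs <;> simp
  · simpa only [Matrix.GeneralLinearGroup.map_id, MonoidHom.id_apply] using hu (RingHom.id ℤ_[5]) s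

/-! ### Model `A = 𝒪_L`, `L ⊆ ℚ̄₅` finite over `ℚ₅` (every `e`, `f`) -/

section intermediateField

open Literature.NumberTheory.GaloisRepresentations

variable {p : ℕ} [Fact p.Prime] (L : IntermediateField ℚ_[p] (PadicAlgCl p))

/-- `‖algebraMap ℚ_p L q‖ = ‖q‖`. -/
theorem norm_algebraMap_intermediateField (q : ℚ_[p]) : ‖algebraMap ℚ_[p] L q‖ = ‖q‖ := by
  rw [intermediateFieldIntegers.norm_coe]
  have h : ((algebraMap ℚ_[p] L q : L) : PadicAlgCl p) = algebraMap ℚ_[p] (PadicAlgCl p) q :=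
    (IsScalarTower.algebraMap_apply ℚ_[p] L (PadicAlgCl p) q).symm
  rw [h, norm_algebraMap']

/-- **The structure map `ℤ_p → 𝒪_L` exists** (restriction of `ℚ_p → L` to the unit balls): the conclusions
«for every ring map `φ : ℤ_p → 𝒪_L`» below are not vacuous. -/
theorem exists_ringHom_padicInt_intermediateFieldIntegers :
    ∃ φ : ℤ_[p] →+* intermediateFieldIntegers p L,
      ∀ x : ℤ_[p], ((φ x : intermediateFieldIntegers p L) : L) = algebraMap ℚ_[p] L (x : ℚ_[p]) := by
  have hmem : ∀ x : ℤ_[p],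
      ((algebraMap ℚ_[p] L).comp (PadicInt.Coe.ringHom (p := p))) x ∈
        (intermediateFieldIntegers p L).toSubring := by
    intro x
    change algebraMap ℚ_[p] L (x : ℚ_[p]) ∈ intermediateFieldIntegers p L
    rw [intermediateFieldIntegers.mem_iff_norm_le_one, norm_algebraMap_intermediateField]
    exact PadicInt.norm_le_one x
  exact ⟨((algebraMap ℚ_[p] L).comp (PadicInt.Coe.ringHom (p := p))).codRestrict
    (intermediateFieldIntegers p L).toSubring hmem, fun x => rfl⟩

/-- `↑p ∈ 𝔪_L`. -/
theorem natCast_mem_maximalIdeal_intermediateFieldIntegers :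
    ((p : ℕ) : intermediateFieldIntegers p L) ∈ maximalIdeal (intermediateFieldIntegers p L) :=
  intermediateFieldIntegers.natCast_mem_maximalIdeal (p := p) L

variable [FiniteDimensional ℚ_[p] L]

/-- `𝔪`-adic approximations converge in `𝒪_L`. -/
theorem intermediateFieldIntegers_tendsto_of_forall_sub_mem_pow (x : ℕ → intermediateFieldIntegers p L)
    (y : intermediateFieldIntegers p L)
    (h : ∀ n, x n - y ∈ maximalIdeal (intermediateFieldIntegers p L) ^ n) : Tendsto x atTop (𝓝 y) := by
  rw [tendsto_subtype_rng, ← tendsto_sub_nhds_zero_iff]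
  refine squeeze_zero_norm (a := fun n => ‖(intermediateFieldIntegers.uniformizer L : L)‖ ^ n)
    (fun n => ?_) ?_
  · have hn := (intermediateFieldIntegers.mem_maximalIdeal_pow_iff L n _).1 (h n)
    simpa only [AddSubgroupClass.coe_sub] using hn
  · exact tendsto_pow_atTop_nhds_zero_of_lt_one (norm_nonneg _)
      (intermediateFieldIntegers.norm_uniformizer_lt_one L)

end intermediateField

section intermediateFieldFive

open Literature.NumberTheory.GaloisRepresentations

variable [Fact (Nat.Prime 5)] (L : IntermediateField ℚ_[5] (PadicAlgCl 5)) [FiniteDimensional ℚ_[5] L]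

/-- **(C0) (T5′) at `A = 𝒪_L` for EVERY finite `L/ℚ₅` inside `ℚ̄₅` (every Δ1 ring), Kato's shape.** Let
`G, N ≤ GL₂(𝒪_L)` be closed subgroups, `N` containing every commutator of elements of `G`, with
`G mod 𝔪_L ⊇ GL₂(𝔽₅)`. Then some `u ∈ GL₂(𝒪_L)`, `u ≡ 1 (mod 𝔪_L)`, satisfies `u · φ(s) · u⁻¹ ∈ G` and `∈ N`
for every ring map `φ : ℤ₅ → 𝒪_L` (one exists: `exists_ringHom_padicInt_intermediateFieldIntegers`) and
every `s ∈ SL₂(ℤ₅)`. -/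
theorem exists_conj_SL2_le_of_isClosed_intermediateFieldIntegers
    (G N : Subgroup (GL (Fin 2) (intermediateFieldIntegers 5 L)))
    (hG : IsClosed (G : Set (GL (Fin 2) (intermediateFieldIntegers 5 L))))
    (hN : IsClosed (N : Set (GL (Fin 2) (intermediateFieldIntegers 5 L))))
    (hGN : ∀ a ∈ G, ∀ b ∈ G, a * b * a⁻¹ * b⁻¹ ∈ N)
    (hres : ∀ q : GL (Fin 2) (ZMod 5), ∃ g ∈ G, ∀ i j,
      g.val i j - ((q.val i j).val : ℕ) ∈ maximalIdeal (intermediateFieldIntegers 5 L)) :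
    ∃ u : GL (Fin 2) (intermediateFieldIntegers 5 L),
      (∀ i j, u.val i j - (1 : Matrix (Fin 2) (Fin 2) (intermediateFieldIntegers 5 L)) i j ∈
        maximalIdeal (intermediateFieldIntegers 5 L)) ∧
      ∀ (φ : ℤ_[5] →+* intermediateFieldIntegers 5 L) (s : SL(2, ℤ_[5])),
        u * Matrix.GeneralLinearGroup.map φ (Matrix.SpecialLinearGroup.toGL s) * u⁻¹ ∈ G ∧
          u * Matrix.GeneralLinearGroup.map φ (Matrix.SpecialLinearGroup.toGL s) * u⁻¹ ∈ N := by
  haveI := intermediateFieldIntegers.finite_residueField (p := 5) L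
  exact exists_conj_SL2_padicInt_le_of_isClosed_of_commutator_le
    (intermediateFieldIntegers_tendsto_of_forall_sub_mem_pow L)
    (by exact_mod_cast natCast_mem_maximalIdeal_intermediateFieldIntegers (p := 5) L) G N hG hN hGN hres

end intermediateFieldFive

/-! ### Continuous representations of compact groups: the images are closed -/

section compactImage

open Literature.NumberTheory.GaloisRepresentations

variable {Γ : Type*} [Group Γ] [TopologicalSpace Γ] [CompactSpace Γ]

/-- **(C0)+(C1) at `A = ℤ₅`.** Let `ρ : Γ → GL₂(ℤ₅)` be a continuous representation of a compact group `Γ`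
(e.g. `G_ℚ`) whose reduction `Γ → GL₂(𝔽₅)` is onto, and `Γ₀ ≤ Γ` a closed subgroup containing the
commutators (e.g. `Gal(ℚ̄/ℚ(ζ_{5^∞}))`, the extension `ℚ(ζ_{5^∞})/ℚ` being abelian). Then for some
`u ≡ 1 (mod 5)`: `u · SL₂(ℤ₅) · u⁻¹ ⊆ ρ(Γ₀)` (and `⊆ ρ(Γ)`) — Kato's (12.5.2) for the basis `u·e`. The ONLY
hypothesis on `ρ` beyond continuity is the residual one. -/
theorem exists_conj_SL2_le_range_padicInt [Fact (Nat.Prime 5)] (ρ : Γ →* GL (Fin 2) ℤ_[5])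
    (hρ : Continuous ρ) (Γ₀ : Subgroup Γ) (hΓ₀ : IsClosed (Γ₀ : Set Γ))
    (hcomm : ∀ a b : Γ, a * b * a⁻¹ * b⁻¹ ∈ Γ₀)
    (hres : ∀ q : GL (Fin 2) (ZMod 5), ∃ γ : Γ, Matrix.GeneralLinearGroup.map PadicInt.toZMod (ρ γ) = q) :
    ∃ u : GL (Fin 2) ℤ_[5], Matrix.GeneralLinearGroup.map PadicInt.toZMod u = 1 ∧
      ∀ s : SL(2, ℤ_[5]),
        u * Matrix.SpecialLinearGroup.toGL s * u⁻¹ ∈ ρ.range ∧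
          u * Matrix.SpecialLinearGroup.toGL s * u⁻¹ ∈ Γ₀.map ρ := by
  have hc : IsClosed ((ρ.range : Subgroup (GL (Fin 2) ℤ_[5])) : Set (GL (Fin 2) ℤ_[5])) := by
    rw [MonoidHom.coe_range]; exact (isCompact_range hρ).isClosed
  have hc₀ : IsClosed ((Γ₀.map ρ : Subgroup (GL (Fin 2) ℤ_[5])) : Set (GL (Fin 2) ℤ_[5])) := by
    rw [Subgroup.coe_map]; exact (hΓ₀.isCompact.image hρ).isClosed
  refine exists_conj_SL2_le_of_isClosed_padicInt ρ.range (Γ₀.map ρ) hc hc₀ ?_ fun q => ?_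
  · rintro a ⟨x, rfl⟩ b ⟨y, rfl⟩
    refine ⟨x * y * x⁻¹ * y⁻¹, hcomm x y, ?_⟩
    simp only [map_mul, map_inv]
  · obtain ⟨γ, h⟩ := hres q
    exact ⟨ρ γ, ⟨γ, rfl⟩, h⟩

/-- **(C0)+(C1) at `A = 𝒪_L`** (every finite `L/ℚ₅` inside `ℚ̄₅`, every Δ1 ring). Let `ρ : Γ → GL₂(𝒪_L)`
be a continuous representation of a compact group `Γ` whose reduction modulo `𝔪_L` covers `GL₂(𝔽₅)`,
and `Γ₀ ≤ Γ` a closed subgroup containing the commutators. Then some `u ≡ 1 (mod 𝔪_L)` satisfies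
`u · φ(SL₂(ℤ₅)) · u⁻¹ ⊆ ρ(Γ₀)` (and `⊆ ρ(Γ)`) for every ring map `φ : ℤ₅ → 𝒪_L`. -/
theorem exists_conj_SL2_le_range_intermediateFieldIntegers [Fact (Nat.Prime 5)]
    (L : IntermediateField ℚ_[5] (PadicAlgCl 5)) [FiniteDimensional ℚ_[5] L]
    (ρ : Γ →* GL (Fin 2) (intermediateFieldIntegers 5 L)) (hρ : Continuous ρ)
    (Γ₀ : Subgroup Γ) (hΓ₀ : IsClosed (Γ₀ : Set Γ)) (hcomm : ∀ a b : Γ, a * b * a⁻¹ * b⁻¹ ∈ Γ₀)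
    (hres : ∀ q : GL (Fin 2) (ZMod 5), ∃ γ : Γ, ∀ i j,
      (ρ γ).val i j - ((q.val i j).val : ℕ) ∈ maximalIdeal (intermediateFieldIntegers 5 L)) :
    ∃ u : GL (Fin 2) (intermediateFieldIntegers 5 L),
      (∀ i j, u.val i j - (1 : Matrix (Fin 2) (Fin 2) (intermediateFieldIntegers 5 L)) i j ∈
        maximalIdeal (intermediateFieldIntegers 5 L)) ∧
      ∀ (φ : ℤ_[5] →+* intermediateFieldIntegers 5 L) (s : SL(2, ℤ_[5])),
        u * Matrix.GeneralLinearGroup.map φ (Matrix.SpecialLinearGroup.toGL s) * u⁻¹ ∈ ρ.range ∧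
          u * Matrix.GeneralLinearGroup.map φ (Matrix.SpecialLinearGroup.toGL s) * u⁻¹ ∈ Γ₀.map ρ := by
  have hc : IsClosed ((ρ.range : Subgroup (GL (Fin 2) (intermediateFieldIntegers 5 L))) :
      Set (GL (Fin 2) (intermediateFieldIntegers 5 L))) := by
    rw [MonoidHom.coe_range]; exact (isCompact_range hρ).isClosed
  have hc₀ : IsClosed ((Γ₀.map ρ : Subgroup (GL (Fin 2) (intermediateFieldIntegers 5 L))) :
      Set (GL (Fin 2) (intermediateFieldIntegers 5 L))) := by
    rw [Subgroup.coe_map]; exact (hΓ₀.isCompact.image hρ).isClosed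
  refine exists_conj_SL2_le_of_isClosed_intermediateFieldIntegers L ρ.range (Γ₀.map ρ) hc hc₀ ?_ fun q => ?_
  · rintro a ⟨x, rfl⟩ b ⟨y, rfl⟩
    refine ⟨x * y * x⁻¹ * y⁻¹, hcomm x y, ?_⟩
    simp only [map_mul, map_inv]
  · obtain ⟨γ, h⟩ := hres q
    exact ⟨ρ γ, ⟨γ, rfl⟩, h⟩

end compactImage

end models

end Summit.BirchSwinnertonDyer.BirchSwinnertonDyer.Theorems.GL2F5AdjointBricks
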